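/-
Copyright: statement-level skeleton of a published paper (lit-balaban cell, Phase-2 proof seat p20 gen 6). No proof claims
beyond what the kernel checks below.
-/
import Literature.MathematicalPhysics.QuantumFieldTheory.Balaban1983to89.B3Eq323CrossTermsZeroTorus
import Literature.MathematicalPhysics.QuantumFieldTheory.Balaban1983to89.B3Eq317ZeroTorus

/-!
# B3 — T. Bałaban, *(Higgs)₂,₃ quantum fields in a finite volume. III. Renormalization*, CMP **88** (1983) 411–445
[Balaban1983Higgs3], p. 439 [PDF 29], **(3.23)** and the sentences around it: *"the second is treated in the same way as the
expression (3.15): we sum over proper orderings and j-indices and we get (3.23) … Rescaling from the η-lattice to the L^{−j″}-lattice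
and using the same method as in (3.16) we get some convergent expressions plus … (3.24) … Hence the last graph in (3.22) defines a
vertex with some convergent function."* — PROVED ON THE η-LATTICE at the zero-field TORUS MODEL INSTANCE (`d = 3`, `A = B̃ = 0`,
`Ω = T_η`): (i) the rescaling sentence as an IDENTITY for the square bracket of (3.23) (ξ-lattice bracket on p39's rescaled propagator
`G0xi` versus the η-lattice bracket on the resummed pieces `Σ_{j<j″}G^η_{(j)}`; equal in `d = 3`), (ii) the summation over `j, j′ < j″`
of the (3.23)-shaped terms of the pieces IS (3.23) with `G^η_{j″}(0)`, `G^η_{j″}`, and (iii) the resulting vertex has a coefficient bounded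
uniformly in the volume and the scale — p39 g6's ξ-lattice bound `B3Eq323CrossTermsZeroTorus.bracket323_G0xi_zero_torus` transported
to the η-lattice, where the rest of Sect. 3 (the (3.22) split, the estimates (3.13)/(3.14)) lives

statement-level skeleton of published theorems with citation tags; proofs where landed; nothing here is a claim about
the Yang–Mills mass gap

PDF held: `paper:balaban1983-higgs-2-3-quantum-fields-finite-volume` (journal page = PDF page + 410); p. 439 [PDF 29] read in the
OCR text (`p0029.txt`).  Row **B3.Eq3.21-3.24** of `HOME/lit-balaban-r15/ROWS-B3.md` (fold owner r15, referee ref-4).  CONSUMES BY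
NAME, nothing re-proved: r15's `B3Sect3ScalarSelfEnergy` (`bracket323`, `expr323`, `d1Kernel`), p20 g4's
`B3Resummation315.expr323_sum_sum` (multilinearity = *"we sum over proper orderings and j-indices"*), p20 g5/g6's
`B3Sect3KernelsZeroTorus.gpiece` and `B3Eq317ZeroTorus.G0xi_eq_rescaled`/`sum_gpiece_apply` (the pieces and the rescaling
dictionary `G^ξ_k(0) = (L^kε)^{d−2}Σ_{j<k}G^η_{(j)}`), p39 g6's `B3GkZeroTorusRescaled` (`G0xi`, `eta_inv_eq`, `spacing_mul_eta`,
`spacing_le_one`) and `B3Eq323CrossTermsZeroTorus.bracket323_G0xi_zero_torus` (the ξ-lattice bound `|[(3.23)]| ≤ C₁ + C₂K′`, every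
kernel hypothesis discharged).

WHAT IS PROVED, and how.
* §1 RESCALING (any `d ≥ 2`, any volume, `k ≥ 1`; `ξ = L^{−k}`, `s = L^kε`, `ε = sξ`): `d1Kernel_rescale` (`(∂^ξ_μG^ξ_k(0))(y,y′) =
  s^{d−1}(∂^η_μG^η_k(0))(x,x′)`), **`bracket323_rescale`** (`s³·[bracket (3.23) on the ξ-lattice] = s^d·[bracket (3.23) on the η-lattice]`),
  `bracket323_rescale_three` (EQUAL in `d = 3`) — *"Rescaling from the η-lattice to the L^{−j″}-lattice"*; `lipschitz_rescale` (a
  localization `g′` with `|g′(x′) − g′(x)| ≤ K·ε|x−x′|₁` on the η-lattice is `(K·s)`-Lipschitz for the ξ-lattice distance).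
* §2 **`abs_bracket323_eta_le`** — for odd `L > 1`, `a > 0`, `m² ≥ 0` there are `C₁, C₂ > 0` with, for every volume `P = (3,L,m,K)`, every
  `1 ≤ k ≤ K`, `|g|,|g′| ≤ 1`, `g′` `K`-Lipschitz (η-lattice), all `μ, x`: `|[bracket (3.23)](G^η_k(0),G^η_k)(x)| ≤ C₁ + C₂K(L^kε)`;
  **`abs_expr323_eta_le`** — hence `|(3.23)| ≤ (C₁ + C₂K(L^kε))·Σ_μΣ_xη³‖φ(x)‖‖q²(∂^η_μφ′)(x)‖`: *"the last graph in (3.22) defines a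
  vertex with some convergent function"* ON THE η-LATTICE (bounded coefficient, uniformly in the volume and in `1 ≤ k ≤ K`).
* §3 **`eq323_zero_torus`** — the two p. 439 sentences together at the instance: `Σ_{j,j′<k}(3.23)-term[G^η_{(j)}(0),G^η_{(j′)}] =
  (3.23)[G^η_k(0),G^η_k]` for the tower pieces (`expr323_sum_sum`) AND the bound of §2, one pair of constants for all volumes and
  scales.
HONEST SCOPE: `d = 3` for §2–§3; `A = B̃ = 0`, `U ≡ 1`, `Ω` = the whole torus; both propagators of (3.23) are pieces of the SAME
zero-field tower (at zero field `G_{(j)}(0) = G_{(j)}`); fixed `a > 0`, `m² ≥ 0`; constants existential; the (3.22) split itself (whose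
pre-Taylor expression for the second graph of (3.21) is printed only as a picture) and the `ξ → 0` limit of (3.24) are NOT claimed
here (row cells: p03 `B3Eq324Parseval`, p39 `B3Eq324Torus`); the summation over orderings is taken literally over `[0,j″)²`, as in
`B3Resummation315`.  Mathlib + the cited tree files only; theorems only, no new definitions, no named facts; standard axioms.
Unit `lit-balaban-p20-g6` (Phase-2 proof seat p20, gen 6), HOME `run/shared/lean/pub/lit-balaban/`, 2026-08-21.
-/

open scoped BigOperators RealInnerProductSpace

namespace Literature.MathematicalPhysics.QuantumFieldTheory.Balaban1983to89.B3Eq323EtaZeroTorus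

open Finset B1RG242Torus B3Ineq210ZeroTorus B3Sect3KernelsZeroTorus B3GkZeroTorusRescaled B3Eq323CrossTermsZeroTorus
open LatticeFieldCalculus B3Sect3ScalarSelfEnergy B3Resummation315 B3Eq317ZeroTorus

noncomputable section

universe u

variable {P : Params}

/-! ## §1 Rescaling of the (3.23) bracket from the η-lattice to the `L^{−j″}`-lattice (p. 439) -/

section Rescaling

/-- p. 439 rescaling, the row-differentiated kernel of (3.23): `(∂^ξ_μG^ξ_k(0))(y,y′) = (L^kε)^{d−1}·(∂^η_μG^η_k(0))(x,x′)`
(`∂^ξ = (L^kε)∂^η`, `G^ξ_k(0) = (L^kε)^{d−2}G^η_k(0)`). [cite: Balaban1983Higgs3, (3.23) p.439] -/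
theorem d1Kernel_rescale {a msq : ℝ} (ha : 0 < a) (hm : 0 ≤ msq) (hd : 2 ≤ P.d) {k : ℕ} (hk : 1 ≤ k) (μ : Fin P.d)
    (y y' : Site P 0) :
    d1Kernel (P.eta k)⁻¹ μ (G0xi P a msq k) y y' =
      P.spacing k ^ (P.d - 1) * d1Kernel P.eps⁻¹ μ (∑ i ∈ range k, gpiece P a msq k i) y y' := by
  simp only [d1Kernel, G0xi_eq_rescaled ha hm hd hk, eta_inv_eq]
  have hsplit : P.spacing k ^ (P.d - 1) = P.spacing k * P.spacing k ^ (P.d - 2) := by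
    rw [← pow_succ']; congr 1; omega
  rw [hsplit]
  ring

/-- **p. 439, the rescaling sentence for the square bracket of (3.23)** — *"Rescaling from the η-lattice to the L^{−j″}-lattice"* —
PROVED in every dimension `d ≥ 2` as the scaling law `(L^kε)³·[bracket (3.23) on the ξ-lattice, G^ξ_k(0), G^ξ_k] =
(L^kε)^d·[bracket (3.23) on the η-lattice, G^η_k(0), G^η_k]` (`ξ^d = (L^kε)^{−d}η^d`, `∂^ξG^ξ(0) = (L^kε)^{d−1}∂^ηG^η(0)`,
`G^ξ = (L^kε)^{d−2}G^η`). [cite: Balaban1983Higgs3, (3.23) p.439] -/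
theorem bracket323_rescale {a msq : ℝ} (ha : 0 < a) (hm : 0 ≤ msq) (hd : 2 ≤ P.d) {k : ℕ} (hk : 1 ≤ k)
    (g g' : SiteField P 0 ℝ) (μ : Fin P.d) (y : Site P 0) :
    P.spacing k ^ 3 * bracket323 (P.eta k) μ (G0xi P a msq k) (G0xi P a msq k) g g' y =
      P.spacing k ^ P.d *
        bracket323 P.eps μ (∑ i ∈ range k, gpiece P a msq k i) (∑ i ∈ range k, gpiece P a msq k i) g g' y := by
  unfold bracket323
  simp only [d1Kernel_rescale ha hm hd hk, G0xi_eq_rescaled ha hm hd hk, Finset.mul_sum]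
  refine Finset.sum_congr rfl fun y' _ => ?_
  have hs : P.spacing k ≠ 0 := (P.spacing_pos k).ne'
  have hξ : P.eta k = P.eps * (P.spacing k)⁻¹ := by
    rw [← spacing_mul_eta P k]; field_simp
  rw [hξ, mul_pow]
  set D := d1Kernel P.eps⁻¹ μ (∑ i ∈ range k, gpiece P a msq k i) y y'
  set G := (∑ i ∈ range k, gpiece P a msq k i) y y'
  -- direct computation: s³·s⁻ᵈ·s^{d−1}·s^{d−2} = s^d
  have key : P.spacing k ^ 3 * ((P.spacing k)⁻¹ ^ P.d * (P.spacing k ^ (P.d - 1) * P.spacing k ^ (P.d - 2))) =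
      P.spacing k ^ P.d := by
    have e1 : P.spacing k ^ 3 * P.spacing k ^ (P.d - 1) * P.spacing k ^ (P.d - 2) = P.spacing k ^ P.d * P.spacing k ^ P.d := by
      rw [← pow_add, ← pow_add, ← pow_add]; congr 1; omega
    calc P.spacing k ^ 3 * ((P.spacing k)⁻¹ ^ P.d * (P.spacing k ^ (P.d - 1) * P.spacing k ^ (P.d - 2)))
        = (P.spacing k)⁻¹ ^ P.d * (P.spacing k ^ 3 * P.spacing k ^ (P.d - 1) * P.spacing k ^ (P.d - 2)) := by ring
      _ = (P.spacing k)⁻¹ ^ P.d * (P.spacing k ^ P.d * P.spacing k ^ P.d) := by rw [e1]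
      _ = ((P.spacing k)⁻¹ ^ P.d * P.spacing k ^ P.d) * P.spacing k ^ P.d := by ring
      _ = P.spacing k ^ P.d := by rw [← mul_pow, inv_mul_cancel₀ hs, one_pow, one_mul]
  calc P.spacing k ^ 3 * (P.eps ^ P.d * (P.spacing k)⁻¹ ^ P.d *
        (P.spacing k ^ (P.d - 1) * D * g y * (P.spacing k ^ (P.d - 2) * G) * g' y'))
      = P.spacing k ^ 3 * ((P.spacing k)⁻¹ ^ P.d * (P.spacing k ^ (P.d - 1) * P.spacing k ^ (P.d - 2))) *
          (P.eps ^ P.d * (D * g y * G * g' y')) := by ring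
    _ = P.spacing k ^ P.d * (P.eps ^ P.d * (D * g y * G * g' y')) := by rw [key]

/-- **p. 439, d = 3: the square bracket of (3.23) is scale-invariant** — the ξ-lattice bracket on `G^ξ_{j″}(0)` EQUALS the η-lattice
bracket on `G^η_{j″}(0)`. [cite: Balaban1983Higgs3, (3.23) p.439] -/
theorem bracket323_rescale_three {a msq : ℝ} (ha : 0 < a) (hm : 0 ≤ msq) (hd : P.d = 3) {k : ℕ} (hk : 1 ≤ k)
    (g g' : SiteField P 0 ℝ) (μ : Fin P.d) (y : Site P 0) :
    bracket323 (P.eta k) μ (G0xi P a msq k) (G0xi P a msq k) g g' y =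
      bracket323 P.eps μ (∑ i ∈ range k, gpiece P a msq k i) (∑ i ∈ range k, gpiece P a msq k i) g g' y := by
  have h := bracket323_rescale ha hm (by omega) hk g g' μ y (a := a) (msq := msq)
  have h3 : P.spacing k ^ P.d = P.spacing k ^ 3 := by rw [hd]
  rw [h3] at h
  exact mul_left_cancel₀ (pow_ne_zero 3 (P.spacing_pos k).ne') h

/-- p. 439 rescaling, the localization function: a `g′` with `|g′(x′) − g′(x)| ≤ K·ε|x−x′|₁` (η-lattice) satisfies
`|g′(y′) − g′(y)| ≤ (K·L^kε)·ξ|y−y′|₁` (ξ-lattice, same sites; `ε = (L^kε)ξ`). [cite: Balaban1983Higgs3, (3.23) p.439] -/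
theorem lipschitz_rescale {K : ℝ} {g' : SiteField P 0 ℝ} (k : ℕ)
    (hg : ∀ x x' : Site P 0, |g' x' - g' x| ≤ K * (P.eps * Site.tdist x x')) (y y' : Site P 0) :
    |g' y' - g' y| ≤ K * P.spacing k * (P.eta k * Site.tdist y y') := by
  have h := hg y y'
  rwa [← spacing_mul_eta P k, show K * (P.spacing k * P.eta k * (Site.tdist y y' : ℝ)) =
    K * P.spacing k * (P.eta k * Site.tdist y y') by ring] at h

end Rescaling

/-! ## §2 The (3.23) vertex on the η-lattice: a bounded coefficient (d = 3) -/

section Vertex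

/-- **p. 439 "Hence the last graph in (3.22) defines a vertex with some convergent function" — THE BRACKET OF (3.23) ON THE η-LATTICE**:
for odd `L > 1`, `a > 0`, `m² ≥ 0` there are `C₁, C₂ > 0` such that for every volume `P = (3, L, m, K)`, every `1 ≤ k ≤ K`, every
`K ≥ 0`, all `|g|, |g′| ≤ 1` with `g′` `K`-Lipschitz for `ε|·|₁`, all `μ`, `x`:
`|[bracket (3.23)](G^η_k(0), G^η_k)(x)| ≤ C₁ + C₂·K·(L^kε)` (p39's `bracket323_G0xi_zero_torus` transported by
`bracket323_rescale_three`, `lipschitz_rescale`). [cite: Balaban1983Higgs3, (3.23) p.439] -/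
theorem abs_bracket323_eta_le (L : ℕ) (hL : Odd L ∧ 1 < L) {a : ℝ} (ha : 0 < a) {msq : ℝ} (hmsq : 0 ≤ msq) :
    ∃ C₁ C₂ : ℝ, 0 < C₁ ∧ 0 < C₂ ∧ ∀ (P : Params), P.d = 3 → P.L = L → ∀ k : ℕ, 1 ≤ k → k ≤ P.K →
      ∀ (K : ℝ), 0 ≤ K → ∀ (g g' : SiteField P 0 ℝ) (μ : Fin P.d), (∀ y, |g y| ≤ 1) → (∀ y, |g' y| ≤ 1) →
        (∀ x x' : Site P 0, |g' x' - g' x| ≤ K * (P.eps * Site.tdist x x')) →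
        ∀ x : Site P 0,
          |bracket323 P.eps μ (∑ i ∈ range k, gpiece P a msq k i) (∑ i ∈ range k, gpiece P a msq k i) g g' x| ≤
            C₁ + C₂ * (K * P.spacing k) := by
  obtain ⟨C₁, C₂, hC₁, hC₂, H⟩ := bracket323_G0xi_zero_torus L hL ha hmsq
  refine ⟨C₁, C₂, hC₁, hC₂, fun P hPd hPL k hk1 hkK K hK g g' μ hg hg' hlip x => ?_⟩
  rw [← bracket323_rescale_three ha hmsq hPd hk1 g g' μ x]
  exact H P hPd hPL k hk1 hkK (K * P.spacing k) (mul_nonneg hK (P.spacing_pos k).le) g g' μ hg hg'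
    (fun y y' => lipschitz_rescale k hlip y y') x

/-- **(3.23), the vertex has a BOUNDED coefficient, on the η-lattice** (d = 3): with the constants of `abs_bracket323_eta_le`, for every
volume, every `1 ≤ k ≤ K`, all `q`, `|g|,|g′| ≤ 1` with `g′` `K`-Lipschitz, `φ`, `φ′`:
`|(3.23)[G^η_k(0), G^η_k]| ≤ (C₁ + C₂K(L^kε))·Σ_μΣ_x η³‖φ(x)‖‖q²(∂^η_μφ′)(x)‖`. [cite: Balaban1983Higgs3, (3.23) p.439] -/
theorem abs_expr323_eta_le (L : ℕ) (hL : Odd L ∧ 1 < L) {a : ℝ} (ha : 0 < a) {msq : ℝ} (hmsq : 0 ≤ msq) :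
    ∃ C₁ C₂ : ℝ, 0 < C₁ ∧ 0 < C₂ ∧ ∀ (P : Params), P.d = 3 → P.L = L → ∀ k : ℕ, 1 ≤ k → k ≤ P.K →
      ∀ {W : Type u} [NormedAddCommGroup W] [InnerProductSpace ℝ W] (q : W →ₗ[ℝ] W) (K : ℝ), 0 ≤ K →
        ∀ (g g' : SiteField P 0 ℝ) (φ φ' : SiteField P 0 W), (∀ y, |g y| ≤ 1) → (∀ y, |g' y| ≤ 1) →
        (∀ x x' : Site P 0, |g' x' - g' x| ≤ K * (P.eps * Site.tdist x x')) →
        |expr323 P.eps q (∑ i ∈ range k, gpiece P a msq k i) (∑ i ∈ range k, gpiece P a msq k i) g g' φ φ'| ≤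
          (C₁ + C₂ * (K * P.spacing k)) *
            ∑ μ : Fin P.d, ∑ x : Site P 0, P.eps ^ P.d * (‖φ x‖ * ‖q (q (pdiff P.eps⁻¹ μ φ' x))‖) := by
  obtain ⟨C₁, C₂, hC₁, hC₂, H⟩ := abs_bracket323_eta_le L hL ha hmsq
  refine ⟨C₁, C₂, hC₁, hC₂, fun P hPd hPL k hk1 hkK W _ _ q K hK g g' φ φ' hg hg' hlip => ?_⟩
  have hε : 0 < P.eps := P.eps_pos
  have hCst : 0 ≤ C₁ + C₂ * (K * P.spacing k) := by have := P.spacing_pos k; positivity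
  unfold expr323
  rw [Finset.mul_sum]
  refine (Finset.abs_sum_le_sum_abs _ _).trans (Finset.sum_le_sum fun μ _ => ?_)
  rw [Finset.mul_sum]
  refine (Finset.abs_sum_le_sum_abs _ _).trans (Finset.sum_le_sum fun x _ => ?_)
  rw [abs_mul, abs_of_nonneg (by positivity : (0 : ℝ) ≤ P.eps ^ P.d), abs_mul]
  have hb := H P hPd hPL k hk1 hkK K hK g g' μ hg hg' hlip x
  have hi : |⟪φ x, q (q (pdiff P.eps⁻¹ μ φ' x))⟫| ≤ ‖φ x‖ * ‖q (q (pdiff P.eps⁻¹ μ φ' x))‖ := abs_real_inner_le_norm _ _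
  have h0 : 0 ≤ ‖φ x‖ * ‖q (q (pdiff P.eps⁻¹ μ φ' x))‖ := by positivity
  calc P.eps ^ P.d * (|bracket323 P.eps μ (∑ i ∈ range k, gpiece P a msq k i) (∑ i ∈ range k, gpiece P a msq k i) g g' x| *
          |⟪φ x, q (q (pdiff P.eps⁻¹ μ φ' x))⟫|)
      ≤ P.eps ^ P.d * ((C₁ + C₂ * (K * P.spacing k)) * (‖φ x‖ * ‖q (q (pdiff P.eps⁻¹ μ φ' x))‖)) :=
        mul_le_mul_of_nonneg_left (mul_le_mul hb hi (abs_nonneg _) hCst) (by positivity)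
    _ = (C₁ + C₂ * (K * P.spacing k)) * (P.eps ^ P.d * (‖φ x‖ * ‖q (q (pdiff P.eps⁻¹ μ φ' x))‖)) := by ring

end Vertex

/-! ## §3 (3.23) at the instance: the summation over j, j′ < j″ and the bounded vertex -/

section Eq323

/-- **(3.23) p. 439 AT THE ZERO-FIELD TORUS MODEL INSTANCE, d = 3** — *"we sum over proper orderings and j-indices and we get (3.23)
… Hence the last graph in (3.22) defines a vertex with some convergent function"*: for odd `L > 1`, `a > 0`, `m² ≥ 0` there are
`C₁, C₂ > 0` such that for EVERY volume `P = (3, L, m, K)`, every `1 ≤ k ≤ K` (`k = j″`), every `q`, `K ≥ 0`, `|g|,|g′| ≤ 1` with `g′`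
`K`-Lipschitz (`|g′(x′) − g′(x)| ≤ Kε|x−x′|₁`), all `φ, φ′`:
(a) `Σ_{j,j′<k}(3.23)-term[G^η_{(j)}(0), G^η_{(j′)}] = (3.23)[G^η_k(0), G^η_k]` for the tower pieces `gpiece` (multilinearity,
`expr323_sum_sum`); (b) `|(3.23)[G^η_k(0), G^η_k]| ≤ (C₁ + C₂K(L^kε))·Σ_μΣ_xη³‖φ(x)‖‖q²(∂^η_μφ′)(x)‖`.
[cite: Balaban1983Higgs3, (3.23) p.439] -/
theorem eq323_zero_torus (L : ℕ) (hL : Odd L ∧ 1 < L) {a : ℝ} (ha : 0 < a) {msq : ℝ} (hmsq : 0 ≤ msq) :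
    ∃ C₁ C₂ : ℝ, 0 < C₁ ∧ 0 < C₂ ∧ ∀ (P : Params), P.d = 3 → P.L = L → ∀ k : ℕ, 1 ≤ k → k ≤ P.K →
      ∀ {W : Type u} [NormedAddCommGroup W] [InnerProductSpace ℝ W] (q : W →ₗ[ℝ] W) (K : ℝ), 0 ≤ K →
        ∀ (g g' : SiteField P 0 ℝ) (φ φ' : SiteField P 0 W), (∀ y, |g y| ≤ 1) → (∀ y, |g' y| ≤ 1) →
        (∀ x x' : Site P 0, |g' x' - g' x| ≤ K * (P.eps * Site.tdist x x')) →
          (∑ i ∈ range k, ∑ i' ∈ range k, expr323 P.eps q (gpiece P a msq k i) (gpiece P a msq k i') g g' φ φ' =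
              expr323 P.eps q (∑ i ∈ range k, gpiece P a msq k i) (∑ i ∈ range k, gpiece P a msq k i) g g' φ φ') ∧
          |expr323 P.eps q (∑ i ∈ range k, gpiece P a msq k i) (∑ i ∈ range k, gpiece P a msq k i) g g' φ φ'| ≤
            (C₁ + C₂ * (K * P.spacing k)) *
              ∑ μ : Fin P.d, ∑ x : Site P 0, P.eps ^ P.d * (‖φ x‖ * ‖q (q (pdiff P.eps⁻¹ μ φ' x))‖) := by
  obtain ⟨C₁, C₂, hC₁, hC₂, H⟩ := abs_expr323_eta_le.{u} L hL ha hmsq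
  refine ⟨C₁, C₂, hC₁, hC₂, fun P hPd hPL k hk1 hkK W _ _ q K hK g g' φ φ' hg hg' hlip => ⟨?_, ?_⟩⟩
  · exact expr323_sum_sum (range k) (range k) P.eps q (fun i => gpiece P a msq k i) (fun i => gpiece P a msq k i) g g' φ φ'
  · exact H P hPd hPL k hk1 hkK q K hK g g' φ φ' hg hg' hlip

/-- **(3.23) on the η-lattice with a scale-free Lipschitz constant**: since `L^kε ≤ 1` for `k ≤ K`, the coefficient bound of
`eq323_zero_torus` is `≤ C₁ + C₂K`, uniformly in the volume and the scale. [cite: Balaban1983Higgs3, (3.23) p.439] -/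
theorem abs_expr323_eta_le_uniform (L : ℕ) (hL : Odd L ∧ 1 < L) {a : ℝ} (ha : 0 < a) {msq : ℝ} (hmsq : 0 ≤ msq) :
    ∃ C₁ C₂ : ℝ, 0 < C₁ ∧ 0 < C₂ ∧ ∀ (P : Params), P.d = 3 → P.L = L → ∀ k : ℕ, 1 ≤ k → k ≤ P.K →
      ∀ {W : Type u} [NormedAddCommGroup W] [InnerProductSpace ℝ W] (q : W →ₗ[ℝ] W) (K : ℝ), 0 ≤ K →
        ∀ (g g' : SiteField P 0 ℝ) (φ φ' : SiteField P 0 W), (∀ y, |g y| ≤ 1) → (∀ y, |g' y| ≤ 1) →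
        (∀ x x' : Site P 0, |g' x' - g' x| ≤ K * (P.eps * Site.tdist x x')) →
        |expr323 P.eps q (∑ i ∈ range k, gpiece P a msq k i) (∑ i ∈ range k, gpiece P a msq k i) g g' φ φ'| ≤
          (C₁ + C₂ * K) * ∑ μ : Fin P.d, ∑ x : Site P 0, P.eps ^ P.d * (‖φ x‖ * ‖q (q (pdiff P.eps⁻¹ μ φ' x))‖) := by
  obtain ⟨C₁, C₂, hC₁, hC₂, H⟩ := abs_expr323_eta_le.{u} L hL ha hmsq
  refine ⟨C₁, C₂, hC₁, hC₂, fun P hPd hPL k hk1 hkK W _ _ q K hK g g' φ φ' hg hg' hlip => ?_⟩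
  refine (H P hPd hPL k hk1 hkK q K hK g g' φ φ' hg hg' hlip).trans (mul_le_mul_of_nonneg_right ?_ ?_)
  · have hs1 : P.spacing k ≤ 1 := spacing_le_one P hkK
    have : K * P.spacing k ≤ K := by nlinarith [P.spacing_pos k]
    nlinarith
  · exact Finset.sum_nonneg fun μ _ => Finset.sum_nonneg fun x _ => by
      have := P.eps_pos; positivity

end Eq323

end

end Literature.MathematicalPhysics.QuantumFieldTheory.Balaban1983to89.B3Eq323EtaZeroTorus
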